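import Summits.Ventures.PercRepro.C041TwoExitSix

/-!
# ROW C-041 — COUNTING TUPLES OVER A PARTITION INTO BLOCKS (p6, gen 33; the combinatorial core of the block map
with `r` exits, mine-3's C-041.md §20 (c))

Tuples `τ : (k : ι) → S k` over a finite index type, with a set `M` of MERGED coordinates and a family `𝔅` of
pairwise disjoint BLOCKS covering the rest.  The tuples whose merged coordinates lie in prescribed sets `A k` and
whose every block `B` has all its coordinates in `P k` or all in `Q k` are counted by
`∏_{k ∈ M} #(A k) · ∏_{B ∈ 𝔅} (∏_{k ∈ B} #(P k) + ∏_{k ∈ B} #(Q k) − ∏_{k ∈ B} #(P k ∩ Q k))`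
(`card_filter_blocks`): the inclusion–exclusion of one block, multiplied over the blocks.  The proof sums the
INDICATOR of the condition — a product over `M` of one-coordinate indicators times a product over the blocks of
the block weights `blockW` — and peels the blocks off one at a time (`sum_prod_M_blocks`, induction on `𝔅`: a
block whose weight is resolved into one of its three terms joins the merged coordinates), the base case being the
product formula `∑_τ ∏_k [τ k ∈ A k] = ∏_k #(A k)` (`sum_prod_ind`, `Fintype.prod_sum`).
-/

namespace PercRepro

namespace ZoneZ

namespace BlockCount

open Finset

variable {ι : Type} [Fintype ι] [DecidableEq ι] {S : ι → Type} [∀ k, Fintype (S k)] [∀ k, DecidableEq (S k)]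

/-- The indicator of membership, as a real number. -/
noncomputable def ind {k : ι} (A : Finset (S k)) (x : S k) : ℝ := if x ∈ A then 1 else 0

/-- The weight of a tuple at a block `B`: `∏_{k ∈ B} [τ k ∈ P k] + ∏_{k ∈ B} [τ k ∈ Q k] − ∏_{k ∈ B} [τ k ∈ P k ∩ Q k]`. -/
noncomputable def blockW (P Q : (k : ι) → Finset (S k)) (B : Finset ι) (τ : (k : ι) → S k) : ℝ :=
  (∏ k ∈ B, ind (P k) (τ k)) + (∏ k ∈ B, ind (Q k) (τ k)) - ∏ k ∈ B, ind (P k ∩ Q k) (τ k)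

/-- The count of a block: `∏_{k ∈ B} #(P k) + ∏_{k ∈ B} #(Q k) − ∏_{k ∈ B} #(P k ∩ Q k)`. -/
noncomputable def blockC (P Q : (k : ι) → Finset (S k)) (B : Finset ι) : ℝ :=
  (∏ k ∈ B, (#(P k) : ℝ)) + (∏ k ∈ B, (#(Q k) : ℝ)) - ∏ k ∈ B, (#(P k ∩ Q k) : ℝ)

omit [Fintype ι] [DecidableEq ι] in
/-- The sum of an indicator over a coordinate is the cardinality. -/
theorem sum_ind {k : ι} (A : Finset (S k)) : ∑ x, ind A x = #A := by
  unfold ind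
  rw [Finset.sum_boole, Finset.filter_mem_eq_inter, Finset.univ_inter]

/-- **The product formula**: `∑_τ ∏_k [τ k ∈ A k] = ∏_k #(A k)`. -/
theorem sum_prod_ind (A : (k : ι) → Finset (S k)) :
    ∑ τ : (k : ι) → S k, ∏ k, ind (A k) (τ k) = ∏ k, (#(A k) : ℝ) := by
  rw [← Fintype.prod_sum]
  exact Finset.prod_congr rfl fun k _ => sum_ind (A k)

omit [(k : ι) → Fintype (S k)] in
/-- A product of one-coordinate indicators over a set is the indicator of the conjunction. -/
theorem prod_ind_eq_ite (A : (k : ι) → Finset (S k)) (M : Finset ι) (τ : (k : ι) → S k) :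
    ∏ k ∈ M, ind (A k) (τ k) = if ∀ k ∈ M, τ k ∈ A k then 1 else 0 := by
  unfold ind
  rw [Finset.prod_boole]
  by_cases h : ∀ k ∈ M, τ k ∈ A k <;> simp [h]

omit [(k : ι) → Fintype (S k)] in
/-- The block weight is the indicator of «all in `P` or all in `Q`». -/
theorem blockW_eq_ite (P Q : (k : ι) → Finset (S k)) (B : Finset ι) (τ : (k : ι) → S k) :
    blockW P Q B τ = if (∀ k ∈ B, τ k ∈ P k) ∨ (∀ k ∈ B, τ k ∈ Q k) then 1 else 0 := by
  unfold blockW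
  rw [prod_ind_eq_ite, prod_ind_eq_ite, prod_ind_eq_ite]
  have hpq : (∀ k ∈ B, τ k ∈ P k ∩ Q k) ↔ (∀ k ∈ B, τ k ∈ P k) ∧ (∀ k ∈ B, τ k ∈ Q k) := by
    simp only [Finset.mem_inter]
    exact ⟨fun h => ⟨fun k hk => (h k hk).1, fun k hk => (h k hk).2⟩, fun h k hk => ⟨h.1 k hk, h.2 k hk⟩⟩
  by_cases hp : ∀ k ∈ B, τ k ∈ P k
  · by_cases hq : ∀ k ∈ B, τ k ∈ Q k
    · rw [if_pos hp, if_pos hq, if_pos (hpq.2 ⟨hp, hq⟩), if_pos (Or.inl hp)]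
      ring
    · rw [if_pos hp, if_neg hq, if_neg (fun h => hq (hpq.1 h).2), if_pos (Or.inl hp)]
      ring
  · by_cases hq : ∀ k ∈ B, τ k ∈ Q k
    · rw [if_neg hp, if_pos hq, if_neg (fun h => hp (hpq.1 h).1), if_pos (Or.inr hq)]
      ring
    · rw [if_neg hp, if_neg hq, if_neg (fun h => hp (hpq.1 h).1), if_neg (fun h => h.elim hp hq)]
      ring

/-- **Peeling the blocks**: the sum over the tuples of the merged indicators times the block weights is the product
of the merged counts and the block counts (for pairwise disjoint blocks covering the non-merged coordinates). -/
theorem sum_prod_M_blocks (P Q : (k : ι) → Finset (S k)) (𝔅 : Finset (Finset ι)) :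
    ∀ (M : Finset ι) (A : (k : ι) → Finset (S k)), (∀ B ∈ 𝔅, Disjoint M B) →
      (∀ B ∈ 𝔅, ∀ B' ∈ 𝔅, B ≠ B' → Disjoint B B') → (∀ k, k ∈ M ∨ ∃ B ∈ 𝔅, k ∈ B) →
      ∑ τ : (k : ι) → S k, (∏ k ∈ M, ind (A k) (τ k)) * ∏ B ∈ 𝔅, blockW P Q B τ =
        (∏ k ∈ M, (#(A k) : ℝ)) * ∏ B ∈ 𝔅, blockC P Q B := by
  induction 𝔅 using Finset.induction_on with
  | empty =>
    intro M A _ _ hcov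
    have hM : M = univ := by
      rw [Finset.eq_univ_iff_forall]
      intro k
      rcases hcov k with h | ⟨B, hB, -⟩
      · exact h
      · simp at hB
    subst hM
    simp only [Finset.prod_empty, mul_one]
    exact sum_prod_ind A
  | insert B₀ 𝔅' hB₀ ih =>
    intro M A hMB hBB hcov
    have hMB₀ : Disjoint M B₀ := hMB B₀ (mem_insert_self _ _)
    have hMB' : ∀ B ∈ 𝔅', Disjoint (M ∪ B₀) B := fun B hB =>
      Finset.disjoint_union_left.2 ⟨hMB B (mem_insert_of_mem hB),
        hBB B₀ (mem_insert_self _ _) B (mem_insert_of_mem hB) (fun h => hB₀ (h ▸ hB))⟩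
    have hBB' : ∀ B ∈ 𝔅', ∀ B' ∈ 𝔅', B ≠ B' → Disjoint B B' := fun B hB B' hB' h =>
      hBB B (mem_insert_of_mem hB) B' (mem_insert_of_mem hB') h
    have hcov' : ∀ k, k ∈ M ∪ B₀ ∨ ∃ B ∈ 𝔅', k ∈ B := by
      intro k
      rcases hcov k with h | ⟨B, hB, hk⟩
      · exact Or.inl (mem_union_left _ h)
      · rcases mem_insert.1 hB with rfl | hB
        · exact Or.inl (mem_union_right _ hk)
        · exact Or.inr ⟨B, hB, hk⟩
    have step : ∀ W : (k : ι) → Finset (S k),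
        ∑ τ : (k : ι) → S k, (∏ k ∈ M, ind (A k) (τ k)) *
            ((∏ k ∈ B₀, ind (W k) (τ k)) * ∏ B ∈ 𝔅', blockW P Q B τ) =
          (∏ k ∈ M, (#(A k) : ℝ)) * ((∏ k ∈ B₀, (#(W k) : ℝ)) * ∏ B ∈ 𝔅', blockC P Q B) := by
      intro W
      have h := ih (M ∪ B₀) (fun k => if k ∈ B₀ then W k else A k) hMB' hBB' hcov'
      simp only [prod_union hMB₀] at h
      have e1 : ∀ τ : (k : ι) → S k,
          ∏ k ∈ M, ind (if k ∈ B₀ then W k else A k) (τ k) = ∏ k ∈ M, ind (A k) (τ k) := by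
        intro τ
        refine prod_congr rfl fun k hk => ?_
        rw [if_neg (Finset.disjoint_left.1 hMB₀ hk)]
      have e2 : ∀ τ : (k : ι) → S k,
          ∏ k ∈ B₀, ind (if k ∈ B₀ then W k else A k) (τ k) = ∏ k ∈ B₀, ind (W k) (τ k) := by
        intro τ
        refine prod_congr rfl fun k hk => ?_
        rw [if_pos hk]
      have e3 : ∏ k ∈ M, (#(if k ∈ B₀ then W k else A k) : ℝ) = ∏ k ∈ M, (#(A k) : ℝ) := by
        refine prod_congr rfl fun k hk => ?_
        rw [if_neg (Finset.disjoint_left.1 hMB₀ hk)]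
      have e4 : ∏ k ∈ B₀, (#(if k ∈ B₀ then W k else A k) : ℝ) = ∏ k ∈ B₀, (#(W k) : ℝ) := by
        refine prod_congr rfl fun k hk => ?_
        rw [if_pos hk]
      simp only [e1, e2, e3, e4] at h
      refine Eq.trans ?_ (h.trans (by ring))
      refine Finset.sum_congr rfl fun τ _ => ?_
      ring
    simp only [prod_insert hB₀]
    have e : ∀ τ : (k : ι) → S k,
        (∏ k ∈ M, ind (A k) (τ k)) * (blockW P Q B₀ τ * ∏ B ∈ 𝔅', blockW P Q B τ) =
          (∏ k ∈ M, ind (A k) (τ k)) * ((∏ k ∈ B₀, ind (P k) (τ k)) * ∏ B ∈ 𝔅', blockW P Q B τ) +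
            (∏ k ∈ M, ind (A k) (τ k)) * ((∏ k ∈ B₀, ind (Q k) (τ k)) * ∏ B ∈ 𝔅', blockW P Q B τ) -
            (∏ k ∈ M, ind (A k) (τ k)) * ((∏ k ∈ B₀, ind (P k ∩ Q k) (τ k)) * ∏ B ∈ 𝔅', blockW P Q B τ) := by
      intro τ
      unfold blockW
      ring
    rw [Finset.sum_congr rfl fun τ _ => e τ, Finset.sum_sub_distrib, Finset.sum_add_distrib, step P, step Q,
      step (fun k => P k ∩ Q k)]
    unfold blockC
    ring

/-- **Counting over a partition into blocks**: the tuples whose merged coordinates lie in `A k` and whose every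
block has all its coordinates in `P k` or all in `Q k` number `∏_{k ∈ M} #(A k) · ∏_{B ∈ 𝔅} blockC P Q B`. -/
theorem card_filter_blocks (P Q : (k : ι) → Finset (S k)) (𝔅 : Finset (Finset ι)) (M : Finset ι)
    (A : (k : ι) → Finset (S k)) (hMB : ∀ B ∈ 𝔅, Disjoint M B)
    (hBB : ∀ B ∈ 𝔅, ∀ B' ∈ 𝔅, B ≠ B' → Disjoint B B') (hcov : ∀ k, k ∈ M ∨ ∃ B ∈ 𝔅, k ∈ B)
    (cond : ((k : ι) → S k) → Prop) [DecidablePred cond]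
    (hcond : ∀ τ, cond τ ↔ (∀ k ∈ M, τ k ∈ A k) ∧ ∀ B ∈ 𝔅, (∀ k ∈ B, τ k ∈ P k) ∨ (∀ k ∈ B, τ k ∈ Q k)) :
    (#(univ.filter cond) : ℝ) = (∏ k ∈ M, (#(A k) : ℝ)) * ∏ B ∈ 𝔅, blockC P Q B := by
  rw [← sum_prod_M_blocks P Q 𝔅 M A hMB hBB hcov, ← Finset.sum_boole]
  refine Finset.sum_congr rfl fun τ _ => ?_
  have e : ∏ B ∈ 𝔅, blockW P Q B τ =
      if ∀ B ∈ 𝔅, (∀ k ∈ B, τ k ∈ P k) ∨ (∀ k ∈ B, τ k ∈ Q k) then 1 else 0 := by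
    rw [Finset.prod_congr rfl fun B _ => blockW_eq_ite P Q B τ, Finset.prod_boole]
    by_cases h : ∀ B ∈ 𝔅, (∀ k ∈ B, τ k ∈ P k) ∨ (∀ k ∈ B, τ k ∈ Q k) <;> simp [h]
  rw [prod_ind_eq_ite, e]
  by_cases hc : cond τ
  · obtain ⟨hX, hY⟩ := (hcond τ).1 hc
    rw [if_pos hc, if_pos hX, if_pos hY]
    ring
  · rw [if_neg hc]
    by_cases hX : ∀ k ∈ M, τ k ∈ A k
    · have hY : ¬ ∀ B ∈ 𝔅, (∀ k ∈ B, τ k ∈ P k) ∨ (∀ k ∈ B, τ k ∈ Q k) :=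
        fun hY => hc ((hcond τ).2 ⟨hX, hY⟩)
      rw [if_neg hY]
      simp
    · rw [if_neg hX]
      simp

end BlockCount

end ZoneZ

end PercRepro
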